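/-
Copyright (c) 2026 the pub-hodgecm-mathlib formalisation cell (harness21).  Prover seat hodgecm-mathlib-LD1-p02 (g0), organ payer of half-A
line LD1 on loan to LD2 — organ C₂at′ `ArchSignAt₂'` of the LD2 skeleton of record (dealer LD2-plan (g0) 2026-09-02T03:17:52Z), 2026-09-02.
THEOREMS ONLY (no definition, no named fact, no `sorry`, no instance, no notation).  `--supports stmt-HodgeConjecture-24832 --as helper`.
-/
import Summits.HodgeConjecture.HodgeConjecture.Theorems.F0LD2ScaledFrameCone
import Summits.HodgeConjecture.HodgeConjecture.Theorems.F0LD2ConeTorusCovariance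
import Summits.HodgeConjecture.HodgeConjecture.Theorems.F0LD2ThetaCyclicity
import Summits.HodgeConjecture.HodgeConjecture.Theorems.F0LD2ThetaTorusEigenclass
import Summits.HodgeConjecture.HodgeConjecture.Theorems.F0LD2ThetaTensorCLM
import Summits.HodgeConjecture.HodgeConjecture.Theorems.F0LD2CurveHolTestVector
import Summits.HodgeConjecture.HodgeConjecture.Theorems.F0LD2FrameTransportPin
import Literature.NumberTheory.Automorphic.Liu2021.ThetaLiftFromLineMeets
import Literature.NumberTheory.Automorphic.Liu2021.Def411WeilCarriersArchPlaceSign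
import Literature.NumberTheory.GelbartRogawski1991.ArchLocalUnitarySurjective
import Literature.NumberTheory.GelbartRogawski1991.QuadExtSplittingCharArchType
import Literature.NumberTheory.Automorphic.IdeleClassBaseChangePosReal
import Literature.NumberTheory.Automorphic.IdeleClassCharacterHecke
import Literature.NumberTheory.Automorphic.ConjugateSelfDualInfinityType
import Literature.NumberTheory.Automorphic.UnitaryGroupDatumScaleInvariance
import Literature.NumberTheory.Automorphic.AdelicUnitaryGroupDatum
import Literature.Geometry.ComplexHyperbolic.UnitBallFrameTorus
import Literature.Analysis.SegalBargmann.SchwartzTorusIdentification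
import HarnessLib

/-!
# Organ C₂at′ of the LD2 skeleton — [Liu2021, App. D Lem. D.2 (3)] at the place of `ι`, rank 2, CONE model, PINNED transport:
# a holomorphic-cotangent `P` of the CM unitary CURVE meeting the theta lift from the line `⟨a′⟩` has `Re e♮(t) · Im e♮(a′·(2·δ_L)⁻¹) < 0`

Cell hodgecm-mathlib FLOOR 0, programme P6, half-A line LD (crux `hLiu418` = `stmt-HodgeConjecture-24832`); organ C₂at′ `ArchSignAt₂'` of the LD2 skeleton of
record v5 (`F0/P6/LD/LD2-plan/g0/StubS1bfacts.inhouse.skeleton.v5.lean` sha16 e8da573259aec245 :325–:356).  Namespace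
`Summit.HodgeConjecture.HodgeConjecture.Cruxes.HLiu418.F0LD2ArchSignAt`.

THE ROAD («K-type of `(1,0)`-forms», the rank-2 cone-model twin of ★ `F0P2oCinfArchTypeAtHolds`; every input ★).  At a real place `v₀` of `L⁺`, `σ = σ_{w(v₀)}`,
the scaled frame `ᵗ(c̄ g)(t•H)g = diag dV` makes the columns `g_p = σ(g) e_p` `σ(H)`-orthogonal with values `σ(dV p)/σ(t)` (★ `F0LD2ScaledFrameCone`); take
`p₋` negative, `p₊` positive.  HOL SIDE: a non-zero class of a holomorphic cotangent form in `P` (★ `F0LD2CurveHolTestVector`), moved to the cone frame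
`(g_{p₋}, g_{p₊})` (★ `exists_archLocal_frame_to_frame`), is an eigenvector of the frame torus `γ_s = σ(g)·diag(s)·σ(g)⁻¹` with character `s_{p₊} s_{p₋}⁻¹`
(★ `rightRegular_adelicSingle_torus_smul`).  THETA SIDE: the pinned `ιA` carries `ι γ_s` to `(diag s at w₀; 1)` (★ `F0LD2PinnedArchSingleTransport`), acting on
the class of a Hermite box vector by `∏_p s_p^{n_p(β)}` (★ `F0LD2ThetaTorusEigenclass`).  PAIRING: cyclicity (★ `F0LD2ThetaCyclicity`), Hermite density
(★ `F0LD2ThetaTensorCLM`, ★ `clm_eq_of_eq_on_hermitePi`), unitarity of `R` and `pr_P ∘ R = R ∘ pr_P` give `∏_p s_p^{n_p} = s_{p₊} s_{p₋}⁻¹` for all unit `s`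
(★ `eq_of_forall_prod_zpow_eq`): `n_{p₊} = 1`, `n_{p₋} = −1`.  The two-index INTEGER EQUATIONS (§1) force `0 < κ · Re σ(t)` (`κ = ρ_{v₀}(a′)/δ_{v₀}`), read by ★
`im_embedding_cmPlaceOver_mul_inv_two_imagUnit` as `Re σ(t) · Im σ(a′(2δ_L)⁻¹) < 0` — TWO-SIDED in the sign of `Re σ(t)` (LD1-plan (g0) 2026-09-02T03:42:40Z:
LD2 takes the `0 < Re ι(t)` instance below, LD1 the relative corollary «same `t`, both hol ⇒ same sign»).

* §1 `integer_equations₂`, `prod_zpow_two_indices`;  §2 **`re_mul_im_lt_zero_of_meets_of_hol₂`** — the two-sided sign theorem at `w₀ = cmPlaceOver L v₀`;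
* §3 `embedding_cmPlace_apply_of_im_eq_zero`, `exists_neg_pos_of_sig₂`, **`archSignAt₂'_holds`** — the organ text `ArchSignAt₂'` (v5 :325–:356) TOKEN FOR TOKEN.

HONEST SCOPE.  This pays ONE organ of the LD2 line of crux hLiu418 (helper, `--supports`); the crux, the line and HC_CM are NOT proved here — HC_CM
stays conditional on the remaining printed inputs (hLiu418, h413) until rung 0 closes.

References: [Liu2021] Y. Liu, arXiv:2102.11518, App. D Lem. D.2 (3) (p. 127 L40 – p. 128 L2), Rem. D.5 (p. 131), proof of Prop. 4.13 Case 1 (l. 2137–2141,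
p. 48); [KonnoKonno2007] Thm. 5.4, Lem. 5.2; [Folland1989] Prop. (4.39); [Borel1997] §5.13–§5.14; [BorelJacquet1979] §4.1, §4.6; [Jacobson] Ch. V §11.
-/

set_option autoImplicit false
set_option linter.dupNamespace false

noncomputable section

open NumberField NumberField.InfinitePlace MeasureTheory IsDedekindDomain Matrix
open scoped Matrix ComplexOrder ENNReal TensorProduct SchwartzMap Classical InnerProductSpace ComplexConjugate

namespace Summit.HodgeConjecture.HodgeConjecture.Cruxes.HLiu418.F0LD2ArchSignAt

open _root_.MeasureTheory
open Literature.NumberTheory.Automorphic Literature.NumberTheory.Automorphic.UnitaryGroup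
open Literature.NumberTheory.Automorphic.UnitaryGroup.CotangentForms (toQuotFun)
open Literature.NumberTheory.Automorphic.UnitaryCurveForms
open Literature.NumberTheory.Automorphic.IdeleClassGroup
open Literature.NumberTheory.Automorphic.Liu2021 Literature.NumberTheory.Automorphic.Liu2021.CinfThetaTorus
open Literature.NumberTheory.Automorphic.Liu2021.Def411WeilCarriers Literature.NumberTheory.Automorphic.Liu2021.Def411WeilCarriersDoubling
open Literature.NumberTheory.GelbartRogawski1991 Literature.NumberTheory.GelbartRogawski1991.UnitaryDualPair
open Literature.NumberTheory.GelbartRogawski1991.GRConstruction Literature.NumberTheory.Weil1964 Literature.RepresentationTheory.Liu2021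
open Literature.RepresentationTheory.HeisenbergGroup Literature.Analysis.SegalBargmann
open Literature.AlgebraicGeometry.ShimuraVarieties Literature.Geometry.ComplexHyperbolic
open Summit.HodgeConjecture.HodgeConjecture.Cruxes.HLiu418.F0LD1ThetaTransportKit
open Summit.HodgeConjecture.HodgeConjecture.Cruxes.HLiu418.F0LD2FrameTransportPin (continuous_of_pin mem_range_toAdelic_of_pin)
open Summit.HodgeConjecture.HodgeConjecture.Cruxes.HLiu418.F0LD2ScaledFrameCone Summit.HodgeConjecture.HodgeConjecture.Cruxes.HLiu418.F0LD2ConeTorusCovariance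
open Summit.HodgeConjecture.HodgeConjecture.Cruxes.HLiu418.F0LD2ThetaCyclicity Summit.HodgeConjecture.HodgeConjecture.Cruxes.HLiu418.F0LD2ThetaTorusEigenclass
open Summit.HodgeConjecture.HodgeConjecture.Cruxes.HLiu418.F0LD2ThetaTensorCLM (exists_clm_comp_toLp_lineThetaLift_tmul)
open Summit.HodgeConjecture.HodgeConjecture.Cruxes.HLiu418.F0LD2CurveHolTestVector (exists_toLp_ne_zero_of_isHolCotangentAt₂)

/-! ## §1 Small algebra: the two-index integer equations and the torus character of a pair of indices -/

/-- THE TWO-INDEX INTEGER EQUATIONS (two-sided in the sign `τi` of the scaling): `κ ≠ 0`, `0 < d₊ τi`, `d₋ τi < 0` and `n₊ = 1`, `n₋ = −1` for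
`n_p = if 0 < d_p κ then c + b_p else c − 1 − b_p` force `0 < κ τi`. [cite: Liu2021, App. D Lem. D.2 (3) (p. 127 L40 – p. 128 L2)] [cite: KonnoKonno2007, Thm. 5.4] -/
theorem integer_equations₂ {c : ℤ} {bp bm : ℕ} {κ τi dp dm : ℝ} (hκ : κ ≠ 0) (hdp : 0 < dp * τi) (hdm : dm * τi < 0)
    (hp : (if 0 < dp * κ then c + bp else c - 1 - bp) = 1) (hm : (if 0 < dm * κ then c + bm else c - 1 - bm) = -1) :
    0 < κ * τi := by
  have hprod : dp * dm < 0 := by nlinarith [mul_pos hdp (neg_pos.2 hdm), sq_nonneg τi]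
  have hκ2 : 0 < κ ^ 2 := by positivity
  split_ifs at hp hm with h1 h2 h2
  · exfalso; nlinarith [mul_pos h1 h2]
  · nlinarith [mul_pos h1 hdp, sq_nonneg dp]
  · exfalso; omega
  · exfalso
    push Not at h1 h2
    nlinarith [mul_nonneg (neg_nonneg.2 h1) (neg_nonneg.2 h2)]

/-- `∏_p (s p)^(A at p₁, B at p₂, 0 else) = (s p₁)^A · (s p₂)^B`. [cite: BrockerTomDieck1985, II Prop. 8.1] -/
theorem prod_zpow_two_indices {n : Type} [Fintype n] [DecidableEq n] (s : n → ℂ) {p₁ p₂ : n} (h12 : p₁ ≠ p₂) (A B : ℤ) :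
    ∏ p, s p ^ (if p = p₁ then A else if p = p₂ then B else 0) = s p₁ ^ A * s p₂ ^ B := by
  rw [← Finset.mul_prod_erase _ _ (Finset.mem_univ p₁), ← Finset.mul_prod_erase _ _ (Finset.mem_erase.2 ⟨Ne.symm h12, Finset.mem_univ p₂⟩),
    Finset.prod_eq_one (fun p hp => by
      obtain ⟨hp2, hp'⟩ := Finset.mem_erase.1 hp
      obtain ⟨hp1, -⟩ := Finset.mem_erase.1 hp'
      rw [if_neg hp1, if_neg hp2, zpow_zero]), mul_one, if_pos rfl, if_neg (Ne.symm h12), if_pos rfl]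

/-! ## §2 The two-sided sign theorem at `w₀ = cmPlaceOver L v₀` -/

set_option maxHeartbeats 4000000 in
-- (the organ's binder list and the theta/frame telescopes are large; every step is a named ★ lemma)
/-- **[Liu2021, Lem. D.2 (3)] AT RANK 2, CONE MODEL, PINNED TRANSPORT, TWO-SIDED.**  `ᵗ(c̄ g)(t•H)g = diag dV`, `w₀ = cmPlaceOver L v₀`, `Im σ_{w₀}(t) = 0`,
`Re(σ_{w₀}(dV p₋)/σ_{w₀}(t)) < 0 < Re(σ_{w₀}(dV p₊)/σ_{w₀}(t))`; if `P` (compact quotient) MEETS the theta lift from `⟨a′⟩` at `μ′` along the pinned `ιA` and is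
HOLOMORPHIC-COTANGENT at `w₀` for a cone frame `𝔣`, then `Re σ_{w₀}(t) · Im σ_{w₀}(a′·(2·imagUnit L)⁻¹) < 0` (road: module docstring; every input ★).
[cite: Liu2021, App. D Lem. D.2 (3) (p. 127 L40 – p. 128 L2); proof of Prop. 4.13 Case 1 (l. 2137–2141, p. 48)] [cite: KonnoKonno2007, Thm. 5.4] [cite: Borel1997, §5.13–§5.14] -/
theorem re_mul_im_lt_zero_of_meets_of_hol₂ (L : Type) [Field L] [NumberField L] [IsCMField L] (H : Matrix (Fin 2) (Fin 2) L)
    (dV : Fin 2 → L) (hdV : ∀ i, IsCMField.complexConj L (dV i) = dV i) (hdV0 : ∀ i, dV i ≠ 0)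
    (t : L) (ht : t ≠ 0) (g : GL (Fin 2) L)
    (hg : formCongr ((IsCMField.complexConj L : L ≃ₐ[↥(maximalRealSubfield L)] L) : L →+* L) g (t • H) = Matrix.diagonal dV)
    (v₀ : {v : InfinitePlace (↥(maximalRealSubfield L)) // v.IsReal}) (w₀ : {w : InfinitePlace L // w.IsComplex}) (hw₀ : w₀ = cmPlaceOver L v₀)
    (hσt : (w₀.1.embedding t).im = 0) (pm pp : Fin 2) (hne : pp ≠ pm)
    (hm : (w₀.1.embedding (dV pm) * (w₀.1.embedding t)⁻¹).re < 0) (hp : 0 < (w₀.1.embedding (dV pp) * (w₀.1.embedding t)⁻¹).re)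
    [CompactSpace (adelicGroupData (↥(maximalRealSubfield L)) L (IsCMField.complexConj L) 2 H).automorphicQuotient]
    (𝔣 : ConeFrame L H w₀)
    {μA : Measure (adelicGroupData (↥(maximalRealSubfield L)) L (IsCMField.complexConj L) 2 H).automorphicQuotient}
    [(adelicGroupData (↥(maximalRealSubfield L)) L (IsCMField.complexConj L) 2 H).IsAutomorphicMeasure μA]
    {n' : ℕ} (e₁ : Fin 2 × Fin 1 ≃ Fin n')
    (ιA : (adelicGroupData (↥(maximalRealSubfield L)) L (IsCMField.complexConj L) 2 H).Adelic →*
      ↥(UnitaryGroup.adelic (↥(maximalRealSubfield L)) L (IsCMField.complexConj L) 2 (Matrix.diagonal dV)))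
    (hιA : ∀ k, ((ιA k : ↥(UnitaryGroup.adelic (↥(maximalRealSubfield L)) L (IsCMField.complexConj L) 2 (Matrix.diagonal dV))) :
          GL (Fin 2) (AdeleRing (𝓞 L) L)) =
        (toAdeleGL L g)⁻¹ * adelicVal (↥(maximalRealSubfield L)) L (IsCMField.complexConj L) 2 H k * toAdeleGL L g)
    [CompactSpace (↥(UnitaryGroup.adelic (↥(maximalRealSubfield L)) L (IsCMField.complexConj L) 2 (Matrix.diagonal dV)) ⧸
        (UnitaryGroup.toAdelic (↥(maximalRealSubfield L)) L (IsCMField.complexConj L) 2 (Matrix.diagonal dV)).range)]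
    (P : DiscreteAutomorphicRep (adelicGroupData (↥(maximalRealSubfield L)) L (IsCMField.complexConj L) 2 H) μA)
    (μ' : Literature.NumberTheory.Automorphic.IdeleClassGroup L →ₜ* Circle) (hμ' : IsConjugateSymplectic L μ')
    (a' : (↥(maximalRealSubfield L))ˣ)
    (hmeets : MeetsThetaLiftFromLine L 2 H e₁ dV hdV hdV0 P μ' hμ' a' ιA)
    (hhol : P.IsHolCotangentAt₂ (IsCMField.complexConj_ne_one L) (UnitaryGroup.complexConj_smul_infinitePlace L) w₀ 𝔣) :
    (w₀.1.embedding t).re * (w₀.1.embedding (algebraMap (↥(maximalRealSubfield L)) L a' * (2 * imagUnit L)⁻¹)).im < 0 := by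
  subst hw₀
  -- instances on the quotient of the small group `U(⟨a′⟩)`
  letI : MeasurableSpace (↥(UnitaryGroup.adelic (↥(maximalRealSubfield L)) L (IsCMField.complexConj L) 1 (JW (↥(maximalRealSubfield L)) L a')) ⧸
      (UnitaryGroup.toAdelic (↥(maximalRealSubfield L)) L (IsCMField.complexConj L) 1 (JW (↥(maximalRealSubfield L)) L a')).range) := borel _
  haveI : BorelSpace (↥(UnitaryGroup.adelic (↥(maximalRealSubfield L)) L (IsCMField.complexConj L) 1 (JW (↥(maximalRealSubfield L)) L a')) ⧸
      (UnitaryGroup.toAdelic (↥(maximalRealSubfield L)) L (IsCMField.complexConj L) 1 (JW (↥(maximalRealSubfield L)) L a')).range) := ⟨rfl⟩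
  haveI := normal_range_toAdelic_JW L a'
  -- the pinned transport is continuous and carries rational points to rational points
  have hιA' : Continuous ιA ∧ ∀ ⦃γ : (adelicGroupData (↥(maximalRealSubfield L)) L (IsCMField.complexConj L) 2 H).Adelic⦄,
      γ ∈ (UnitaryGroup.toAdelic (↥(maximalRealSubfield L)) L (IsCMField.complexConj L) 2 H).range →
        ιA γ ∈ (UnitaryGroup.toAdelic (↥(maximalRealSubfield L)) L (IsCMField.complexConj L) 2 (Matrix.diagonal dV)).range :=
    ⟨continuous_of_pin L 2 H dV g ιA hιA, fun _ hγ => mem_range_toAdelic_of_pin L 2 H dV t ht g hg ιA hιA hγ⟩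
  let d : Fin 2 → ℝ := fun p =>
    embedding_of_isReal v₀.2 (⟨dV p, (IsCMField.complexConj_eq_self_iff (K := L) (dV p)).1 (hdV p)⟩ : ↥(maximalRealSubfield L))
  have hd : ∀ p, (cmPlaceOver L v₀).1.embedding (dV p) = ((d p : ℝ) : ℂ) := fun p => embedding_cmPlaceOver_dV L dV hdV v₀ p
  obtain ⟨tre, htre⟩ : ∃ tre : ℝ, (cmPlaceOver L v₀).1.embedding t = (tre : ℂ) :=
    ⟨((cmPlaceOver L v₀).1.embedding t).re, Complex.ext (by simp) (by simp [hσt])⟩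
  have htre0 : tre ≠ 0 := fun h0 => (map_ne_zero ((cmPlaceOver L v₀).1.embedding)).2 ht (by rw [htre, h0, Complex.ofReal_zero])
  have hre : ∀ p, ((cmPlaceOver L v₀).1.embedding (dV p) * ((cmPlaceOver L v₀).1.embedding t)⁻¹).re = d p * tre⁻¹ := fun p => by
    rw [hd, htre, ← Complex.ofReal_inv, ← Complex.ofReal_mul, Complex.ofReal_re]
  have hmR : d pm * tre⁻¹ < 0 := by rw [← hre]; exact hm
  have hpR : 0 < d pp * tre⁻¹ := by rw [← hre]; exact hp
  -- hermitian form, the cone frame of the columns, frame to frame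
  have hJ := isHermitian_map_of_frame L 2 H dV t ht g hg (cmPlaceOver L v₀) hdV hσt
  obtain ⟨𝔣', h𝔣'v, h𝔣't⟩ := exists_coneFrame_of_columns L H dV t ht g hg (cmPlaceOver L v₀) pm pp hne hm hp
  obtain ⟨h, αh, βh, hα, hβ0, hht, hhv⟩ := exists_archLocal_frame_to_frame hJ 𝔣 𝔣'
  -- the test vector `[f]` and its translate `w = R(ι h)[f] ∈ P`, non-zero
  obtain ⟨fh, hfh, hfm, hfmem, hfne⟩ := exists_toLp_ne_zero_of_isHolCotangentAt₂ (μ := μA) P hhol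
  have hRU := (adelicGroupData (↥(maximalRealSubfield L)) L (IsCMField.complexConj L) 2 H).isUnitary_rightRegular μA
  obtain ⟨wf, hwf⟩ : ∃ wf, wf = (adelicGroupData (↥(maximalRealSubfield L)) L (IsCMField.complexConj L) 2 H).rightRegular μA
      (UnitaryGroup.adelicSingle (↥(maximalRealSubfield L)) L (IsCMField.complexConj L) 2 H (IsCMField.complexConj_ne_one L)
        (UnitaryGroup.complexConj_smul_infinitePlace L) (cmPlaceOver L v₀) h) (hfm.toLp _) := ⟨_, rfl⟩
  have hwmem : wf ∈ P.space.toSubmodule := by rw [hwf]; exact P.space.apply_mem_toSubmodule _ hfmem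
  have hwne : wf ≠ 0 := fun h0 => hfne (by
    rw [← norm_eq_zero, ← hRU.norm_map (UnitaryGroup.adelicSingle (↥(maximalRealSubfield L)) L (IsCMField.complexConj L) 2 H
      (IsCMField.complexConj_ne_one L) (UnitaryGroup.complexConj_smul_infinitePlace L) (cmPlaceOver L v₀) h) (hfm.toLp _), ← hwf, h0, norm_zero])
  -- theta data from the seam: a class `[Θ̃_{Ψ₀}(f_W) ∘ ιA]` in `P`, non-zero
  obtain ⟨hρ, μW, hfinW, hinvW, fW, Ψ₀, hθ, hθmem, hθne⟩ := hmeets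
  haveI : IsFiniteMeasure μW := hfinW
  haveI : SMulInvariantMeasure ↥(UnitaryGroup.adelic (↥(maximalRealSubfield L)) L (IsCMField.complexConj L) 1 (JW (↥(maximalRealSubfield L)) L a'))
      (↥(UnitaryGroup.adelic (↥(maximalRealSubfield L)) L (IsCMField.complexConj L) 1 (JW (↥(maximalRealSubfield L)) L a')) ⧸
        (UnitaryGroup.toAdelic (↥(maximalRealSubfield L)) L (IsCMField.complexConj L) 1 (JW (↥(maximalRealSubfield L)) L a')).range) μW := hinvW
  -- cyclicity: a pure tensor whose projected class pairs non-trivially with `w`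
  obtain ⟨φ, Φf, hφ⟩ := exists_tmul_inner_starProjection_toLp_lineThetaLift_ne_zero_of_mem L 2 H e₁ dV hdV hdV0 ιA hιA' μ' hμ' a' hρ μW fW P Ψ₀
    hθmem hθne hwmem hwne
  -- Hermite density: a Hermite box vector `E(h^V_β ⊗ Φ_f)` with the same property
  obtain ⟨Tθ, hTθ⟩ := exists_clm_comp_toLp_lineThetaLift_tmul L 2 H e₁ dV hdV hdV0 ιA hιA' μ' hμ' a' hρ μW fW μA
    ((innerSL ℂ wf).comp P.space.toSubmodule.starProjection) Φf
  set eV := frameV L e₁ dV hdV hdV0 (lineW L (TW (↥(maximalRealSubfield L)) a')) (complexConj_lineW L (TW (↥(maximalRealSubfield L)) a'))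
    (lineW_ne_zero L (TW (↥(maximalRealSubfield L)) a') (isUnit_det_TW (↥(maximalRealSubfield L)) a')) with heV
  obtain ⟨β, hβ⟩ : ∃ β : (Fin n' × {v : InfinitePlace (↥(maximalRealSubfield L)) // v.IsReal}) →₀ ℕ,
      ⟪wf, P.space.toSubmodule.starProjection (MemLp.toLp _ (memLp_toQuotFun_lineThetaLift L 2 H e₁ dV hdV hdV0 ιA hιA' μ' hμ' a' hρ μW
          (piSchwartzBruhatEquiv (↥(maximalRealSubfield L)) (Fin n') (follandHermite eV β ⊗ₜ Φf)) fW μA 2))⟫_ℂ ≠ 0 := by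
    by_contra hall
    push Not at hall
    have hT0 : Tθ.comp ((schwartzTransport eV).symm : _ ≃L[ℂ] _).toContinuousLinearMap = 0 :=
      clm_eq_of_eq_on_hermitePi fun β' => by
        show Tθ ((schwartzTransport eV).symm (hermitePi β')) = 0
        rw [hTθ]
        exact hall β'
    apply hφ
    have h1 : Tθ φ = 0 := by
      have := congrArg (fun S => S (schwartzTransport eV φ)) hT0
      simpa using this
    rw [hTθ] at h1
    exact h1
  have hτ : (toHeckeCharacter L μ').HasUnitaryArchType hμ'.infinityType 0 :=
    (hasUnitaryArchType_toHeckeCharacter_iff L μ' _).2 hμ'.hasInfinityType_infinityType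
  have hodd : ∀ w, Odd (hμ'.infinityType w) := hμ'.odd_infinityType
  -- THE EIGEN-IDENTITY: `∏_p (s p)^{n p} = s p₊ · (s p₋)⁻¹` for every unit `s`
  have hchar : ∀ s : Fin 2 → ℂ, (∀ p, star (s p) * s p = 1) →
      ∏ p : Fin 2, s p ^ (if 0 < signVec (cmPlaceOver L) (cmGramEntry L e₁ dV hdV (lineW L (TW (↥(maximalRealSubfield L)) a'))
          (complexConj_lineW L (TW (↥(maximalRealSubfield L)) a'))) (imagUnit L) v₀ (e₁ (p, 0))
        then (hμ'.infinityType (cmPlaceOver L v₀).1 + 1) / 2 + β (e₁ (p, 0), v₀)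
        else (hμ'.infinityType (cmPlaceOver L v₀).1 + 1) / 2 - 1 - β (e₁ (p, 0), v₀)) = s pp * (s pm)⁻¹ := by
    intro s hs
    have hs0 : ∀ p, s p ≠ 0 := fun p h0 => by have := hs p; rw [h0, mul_zero] at this; exact zero_ne_one this
    obtain ⟨u, γ, hu, hγ, hcol⟩ := exists_archLocal_torus L 2 H dV t ht g hg ιA hιA (cmPlaceOver L v₀) s hs
    -- hol side: `R(ι γ) w = (s p₊ · (s p₋)⁻¹) • w`
    have hγv : ((γ : GL (Fin 2) ℂ) : Matrix (Fin 2) (Fin 2) ℂ) *ᵥ 𝔣'.v₀ = s pm • 𝔣'.v₀ := by rw [h𝔣'v]; exact hcol pm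
    have hγt : ((γ : GL (Fin 2) ℂ) : Matrix (Fin 2) (Fin 2) ℂ) *ᵥ 𝔣'.t₀ = s pp • 𝔣'.t₀ := by rw [h𝔣't]; exact hcol pp
    have hH := rightRegular_adelicSingle_torus_smul (μ := μA) hfh hfm 𝔣' h γ hα hβ0 (hs0 pm) hht hhv hγv hγt
    rw [← hwf] at hH
    -- theta side: `R(ι γ) θ_β = (∏ s^n) • θ_β`
    have hT := rightRegular_toLp_lineThetaLift_follandHermite_of_eq_adelicSingle L 2 H e₁ dV hdV hdV0 ιA hιA' μ' hμ' a' hρ μW fW μA v₀ hτ hodd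
      s hs u hu _ hγ β Φf
    have key := hRU.inner_map_map (UnitaryGroup.adelicSingle (↥(maximalRealSubfield L)) L (IsCMField.complexConj L) 2 H
      (IsCMField.complexConj_ne_one L) (UnitaryGroup.complexConj_smul_infinitePlace L) (cmPlaceOver L v₀) γ) wf
      (P.space.toSubmodule.starProjection (MemLp.toLp _ (memLp_toQuotFun_lineThetaLift L 2 H e₁ dV hdV hdV0 ιA hιA' μ' hμ' a' hρ μW
        (piSchwartzBruhatEquiv (↥(maximalRealSubfield L)) (Fin n') (follandHermite eV β ⊗ₜ Φf)) fW μA 2)))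
    rw [hH, ← DiscreteAutomorphicRep.starProjection_rightRegular, hT, map_smul, inner_smul_left, inner_smul_right, ← mul_assoc] at key
    have h1 := (mul_eq_right₀ hβ).1 key
    have h2 : (starRingEnd ℂ) (s pp * (s pm)⁻¹) * (s pp * (s pm)⁻¹) = 1 := by
      rw [map_mul, map_inv₀, ← Complex.star_def]
      calc star (s pp) * (star (s pm))⁻¹ * (s pp * (s pm)⁻¹) = (star (s pp) * s pp) * (star (s pm) * s pm)⁻¹ := by rw [mul_inv]; ring
        _ = 1 := by rw [hs pp, hs pm, inv_one, mul_one]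
    have hne0 : (starRingEnd ℂ) (s pp * (s pm)⁻¹) ≠ 0 :=
      (map_ne_zero _).2 (mul_ne_zero (hs0 pp) (inv_ne_zero (hs0 pm)))
    exact mul_left_cancel₀ hne0 (h1.trans h2.symm)
  -- the exponent vector: `n p₊ = 1`, `n p₋ = −1`
  have hvec := BallModel.eq_of_forall_prod_zpow_eq
    (fun p : Fin 2 => if 0 < signVec (cmPlaceOver L) (cmGramEntry L e₁ dV hdV (lineW L (TW (↥(maximalRealSubfield L)) a'))
          (complexConj_lineW L (TW (↥(maximalRealSubfield L)) a'))) (imagUnit L) v₀ (e₁ (p, 0))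
        then (hμ'.infinityType (cmPlaceOver L v₀).1 + 1) / 2 + β (e₁ (p, 0), v₀)
        else (hμ'.infinityType (cmPlaceOver L v₀).1 + 1) / 2 - 1 - β (e₁ (p, 0), v₀))
    (fun p => if p = pp then 1 else if p = pm then -1 else 0) fun s hs => by
      rw [hchar s hs, prod_zpow_two_indices s hne, zpow_one, _root_.zpow_neg, zpow_one]
  have hnp := congrFun hvec pp
  have hnm := congrFun hvec pm
  rw [if_pos rfl] at hnp
  rw [if_neg hne.symm, if_pos rfl] at hnm
  -- the sign vector at `v₀`: `x_{v₀}(e₁(p,0)) = d p · κ`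
  have hsign : ∀ p : Fin 2, signVec (cmPlaceOver L) (cmGramEntry L e₁ dV hdV (lineW L (TW (↥(maximalRealSubfield L)) a'))
      (complexConj_lineW L (TW (↥(maximalRealSubfield L)) a'))) (imagUnit L) v₀ (e₁ (p, 0)) =
      d p * (embedding_of_isReal v₀.2 (a' : ↥(maximalRealSubfield L)) / deltaIm (cmPlaceOver L) (imagUnit L) v₀) := fun p => by
    rw [signVec_cmGramEntry_eq, Equiv.symm_apply_apply, mul_div_assoc]
    rfl
  have hδ0 : deltaIm (cmPlaceOver L) (imagUnit L) v₀ ≠ 0 :=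
    deltaIm_ne_zero (IsCMField.complexConj_ne_one L) (cmPlaceOver_smul L) (complexConj_imagUnit L) (imagUnit_ne_zero L) v₀
  have hκ : embedding_of_isReal v₀.2 (a' : ↥(maximalRealSubfield L)) / deltaIm (cmPlaceOver L) (imagUnit L) v₀ ≠ 0 :=
    div_ne_zero ((map_ne_zero _).2 (Units.ne_zero a')) hδ0
  rw [hsign] at hnp hnm
  have key := integer_equations₂ (c := (hμ'.infinityType (cmPlaceOver L v₀).1 + 1) / 2) hκ hpR hmR hnp hnm
  rw [htre, Complex.ofReal_re, im_embedding_cmPlaceOver_mul_inv_two_imagUnit L v₀ (a' : ↥(maximalRealSubfield L))]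
  have hkt : 0 < embedding_of_isReal v₀.2 (a' : ↥(maximalRealSubfield L)) / deltaIm (cmPlaceOver L) (imagUnit L) v₀ * tre := by
    have h3 : embedding_of_isReal v₀.2 (a' : ↥(maximalRealSubfield L)) / deltaIm (cmPlaceOver L) (imagUnit L) v₀ * tre =
        (embedding_of_isReal v₀.2 (a' : ↥(maximalRealSubfield L)) / deltaIm (cmPlaceOver L) (imagUnit L) v₀ * tre⁻¹) * (tre * tre) := by
      field_simp
    rw [h3]
    exact mul_pos key (mul_self_pos.2 htre0)
  have h4 : tre * (-embedding_of_isReal v₀.2 (a' : ↥(maximalRealSubfield L)) / (2 * deltaIm (cmPlaceOver L) (imagUnit L) v₀)) =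
      -(embedding_of_isReal v₀.2 (a' : ↥(maximalRealSubfield L)) / deltaIm (cmPlaceOver L) (imagUnit L) v₀ * tre) / 2 := by
    field_simp
  rw [h4]
  linarith

/-! ## §3 The organ instance: `ArchSignAt₂'` of the LD2 skeleton (v5 :325–:356), token for token -/

/-- Mathlib's embedding of the place `cmPlace L ι` agrees with `ι` on every `x` with `Im ι(x) = 0` (it is `ι` or `conj ∘ ι`). [folklore] -/
theorem embedding_cmPlace_apply_of_im_eq_zero (L : Type) [Field L] [NumberField L] [IsCMField L] (ι : L →+* ℂ) (x : L) (hx : (ι x).im = 0) :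
    (cmPlace L ι).1.embedding x = ι x := by
  show (InfinitePlace.mk ι).embedding x = ι x
  rcases NumberField.InfinitePlace.embedding_mk_eq ι with h | h
  · rw [h]
  · rw [h, NumberField.ComplexEmbedding.conjugate_coe_eq, Complex.conj_eq_iff_im.2 hx]

/-- `Re(z̄ · (m · z)) = Re m · |z|²`. [folklore] -/
theorem re_star_mul_mul (z m : ℂ) : (star z * (m * z)).re = m.re * Complex.normSq z := by
  rw [show star z * (m * z) = m * (Complex.normSq z : ℂ) by rw [Complex.normSq_eq_conj_mul_self, Complex.star_def]; ring,
    Complex.re_mul_ofReal]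

/-- **SIGNATURE `(1,1)` OF A REAL DIAGONAL `2 × 2` FORM HAS ONE NEGATIVE AND ONE POSITIVE ENTRY**: if `Tᴴ · diag(m) · T = diag(1, −1)` then some
`Re m_{p₋} < 0 < Re m_{p₊}` (the quadratic form at the columns of `T`: `Σ_i Re m_i |T_{i j}|² = ±1`; Sylvester). [cite: Jacobson, Ch. V §11 p. 162] -/
theorem exists_neg_pos_of_sig₂ (m : Fin 2 → ℂ) (T : GL (Fin 2) ℂ)
    (hT : formCongr (starRingEnd ℂ) T (Matrix.diagonal m) = Matrix.diagonal ![(1 : ℂ), -1]) :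
    ∃ pm pp : Fin 2, pp ≠ pm ∧ (m pm).re < 0 ∧ 0 < (m pp).re := by
  have hconj : (((T : Matrix (Fin 2) (Fin 2) ℂ)).map (starRingEnd ℂ))ᵀ = ((T : Matrix (Fin 2) (Fin 2) ℂ))ᴴ := by
    ext i j; simp [Matrix.conjTranspose_apply]
  have hjj : ∀ j : Fin 2, (m 0).re * Complex.normSq ((T : Matrix (Fin 2) (Fin 2) ℂ) 0 j) +
      (m 1).re * Complex.normSq ((T : Matrix (Fin 2) (Fin 2) ℂ) 1 j) = ((Matrix.diagonal ![(1 : ℂ), -1]) j j).re := fun j => by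
    have h := congrFun (congrFun hT j) j
    rw [formCongr, hconj, ← star_col_dotProduct_mulVec_col] at h
    rw [← h]
    simp only [dotProduct, Matrix.mulVec_diagonal, Matrix.col_apply, Pi.star_apply, Fin.sum_univ_two, Complex.add_re, re_star_mul_mul]
  have h0 := hjj 0
  have h1 := hjj 1
  simp only [Matrix.diagonal_apply_eq, Matrix.cons_val_zero, Matrix.cons_val_one, Complex.one_re, Complex.neg_re] at h0 h1
  have n00 := Complex.normSq_nonneg ((T : Matrix (Fin 2) (Fin 2) ℂ) 0 0)
  have n10 := Complex.normSq_nonneg ((T : Matrix (Fin 2) (Fin 2) ℂ) 1 0)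
  have n01 := Complex.normSq_nonneg ((T : Matrix (Fin 2) (Fin 2) ℂ) 0 1)
  have n11 := Complex.normSq_nonneg ((T : Matrix (Fin 2) (Fin 2) ℂ) 1 1)
  rcases lt_or_ge (m 0).re 0 with hm0 | hm0
  · rcases lt_or_ge 0 (m 1).re with hm1 | hm1
    · exact ⟨0, 1, by decide, hm0, hm1⟩
    · exfalso; nlinarith [mul_nonpos_of_nonpos_of_nonneg hm0.le n00, mul_nonpos_of_nonpos_of_nonneg hm1 n10]
  · rcases lt_or_ge (m 1).re 0 with hm1 | hm1
    · rcases lt_or_eq_of_le hm0 with hm0' | hm0'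
      · exact ⟨1, 0, by decide, hm1, hm0'⟩
      · exfalso; rw [← hm0'] at h0; nlinarith [mul_nonpos_of_nonpos_of_nonneg hm1.le n10]
    · exfalso; nlinarith [mul_nonneg hm0 n01, mul_nonneg hm1 n11]

set_option maxHeartbeats 1600000 in
/-- **ORGAN C₂at′ OF THE LD2 SKELETON PAID — `archSignAt₂'_holds : ‹ArchSignAt₂' (v5 :325–:356) body, token for token›** ([Liu2021, Lem. D.2 (3)] at the place
of `ι`, oriented by `0 < Re ι(t)`, `Im ι(t) = 0`: `Im e♮(a′·(2·imagUnit L)⁻¹) < 0`, `e♮ = (cmPlace L ι).1.embedding`) — §2 at the real place below `ι`; `[U(H)]`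
compact by ★ `anisotropic_of_formCongr_smul_eq_of_posDef`; the frame signs from the signature hypothesis (`exists_neg_pos_of_sig₂`).
[cite: Liu2021, App. D Lem. D.2 (3) (p. 127 L40 – p. 128 L2); Rem. D.5 (p. 131)] [cite: KonnoKonno2007, Thm. 5.4] [cite: Rallis1984, Thm. 1.2.2 proof p. 356] -/
theorem archSignAt₂'_holds :
  ∀ (L : Type) [Field L] [NumberField L] [IsCMField L] (ι : L →+* ℂ) (H : Matrix (Fin 2) (Fin 2) L)
    (dV : Fin 2 → L) (hdV : ∀ i, IsCMField.complexConj L (dV i) = dV i) (hdV0 : ∀ i, dV i ≠ 0)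
    (t : L) (ht : t ≠ 0) (hτt : 0 < (ι t).re) (hτt' : (ι t).im = 0) (g : GL (Fin 2) L)
    (hg : formCongr ((IsCMField.complexConj L : L ≃ₐ[↥(maximalRealSubfield L)] L) : L →+* L) g (t • H) = Matrix.diagonal dV),
    (∃ T : GL (Fin 2) ℂ, formCongr (starRingEnd ℂ) T ((Matrix.diagonal dV).map ι) = Matrix.diagonal ![(1 : ℂ), -1]) →
    (∀ τ' : L →+* ℂ, InfinitePlace.mk τ' ≠ InfinitePlace.mk ι → ((Matrix.diagonal dV).map τ').PosDef) →
    4 ≤ Module.finrank ℚ L →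
    ∀ (𝔣 : ConeFrame L H (cmPlace L ι))
      (μ : Measure (adelicGroupData (↥(maximalRealSubfield L)) L (IsCMField.complexConj L) 2 H).automorphicQuotient)
      [(adelicGroupData (↥(maximalRealSubfield L)) L (IsCMField.complexConj L) 2 H).IsAutomorphicMeasure μ]
      {n' : ℕ} (e₁ : Fin 2 × Fin 1 ≃ Fin n')
      (ιA : (adelicGroupData (↥(maximalRealSubfield L)) L (IsCMField.complexConj L) 2 H).Adelic →*
        ↥(UnitaryGroup.adelic (↥(maximalRealSubfield L)) L (IsCMField.complexConj L) 2 (Matrix.diagonal dV))),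
      (∀ k, ((ιA k : ↥(UnitaryGroup.adelic (↥(maximalRealSubfield L)) L (IsCMField.complexConj L) 2 (Matrix.diagonal dV))) :
            GL (Fin 2) (AdeleRing (𝓞 L) L)) =
          (toAdeleGL L g)⁻¹ * adelicVal (↥(maximalRealSubfield L)) L (IsCMField.complexConj L) 2 H k * toAdeleGL L g) →
    ∀ [CompactSpace (↥(UnitaryGroup.adelic (↥(maximalRealSubfield L)) L (IsCMField.complexConj L) 2 (Matrix.diagonal dV)) ⧸
        (UnitaryGroup.toAdelic (↥(maximalRealSubfield L)) L (IsCMField.complexConj L) 2 (Matrix.diagonal dV)).range)],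
    ∀ (P : DiscreteAutomorphicRep (adelicGroupData (↥(maximalRealSubfield L)) L (IsCMField.complexConj L) 2 H) μ)
      (μ' : Literature.NumberTheory.Automorphic.IdeleClassGroup L →ₜ* Circle) (hμ' : IsConjugateSymplectic L μ')
      (a' : (↥(maximalRealSubfield L))ˣ),
      MeetsThetaLiftFromLine L 2 H e₁ dV hdV hdV0 P μ' hμ' a' ιA →
      P.IsHolCotangentAt₂ (IsCMField.complexConj_ne_one L) (UnitaryGroup.complexConj_smul_infinitePlace L) (cmPlace L ι) 𝔣 →
      ((cmPlace L ι).1.embedding (algebraMap (↥(maximalRealSubfield L)) L a' * (2 * imagUnit L)⁻¹)).im < 0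
 := by
  intro L _ _ _ ι H dV hdV hdV0 t ht hτt hτt' g hg hT hpos h4 𝔣 μ _ n' e₁ ιA hpin _ P μ' hμ' a' hmeets hhol
  -- `[U(H)]` is compact: `diag dV` is definite at a place `τ ≠ ι`
  haveI : CompactSpace (adelicGroupData (↥(maximalRealSubfield L)) L (IsCMField.complexConj L) 2 H).automorphicQuotient := by
    obtain ⟨τ, hτ⟩ := UnitaryGroup.exists_infinitePlace_ne L h4 ι
    exact UnitaryGroup.compactSpace_adelicGroupData_automorphicQuotient L 2 H
      (UnitaryGroup.anisotropic_of_formCongr_smul_eq_of_posDef L 2 H dV t ht g hg τ (hpos τ hτ))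
  let v₀ : {v : InfinitePlace (↥(maximalRealSubfield L)) // v.IsReal} :=
    ⟨(InfinitePlace.mk ι).comap (algebraMap (↥(maximalRealSubfield L)) L),
      Literature.NumberTheory.GelbartRogawski1991.UnitaryDualPair.ArchSplitting.QuadExt.isReal_comap_of_smul_eq (F := ↥(maximalRealSubfield L))
        (E := L) (c := IsCMField.complexConj L) (w := ⟨InfinitePlace.mk ι, IsTotallyComplex.isComplex _⟩) (UnitaryGroup.complexConj_smul_infinitePlace L _)
        (IsCMField.complexConj_ne_one L)⟩
  have hw₀ : (cmPlaceOver L v₀).1 = InfinitePlace.mk ι := comap_injective_of_isCMField (L := L) (cmPlaceOver_comap L v₀)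
  have hv₀ : cmPlace L ι = cmPlaceOver L v₀ := (Subtype.ext hw₀).symm
  -- `e♮(t) = ι(t)` is a positive real, `e♮(dV p) = ι(dV p)` is real
  obtain ⟨tr, htr0, htr⟩ : ∃ tr : ℝ, 0 < tr ∧ ι t = (tr : ℂ) := ⟨(ι t).re, hτt, Complex.ext (by simp) (by simp [hτt'])⟩
  have het : (cmPlace L ι).1.embedding t = (tr : ℂ) := by rw [embedding_cmPlace_apply_of_im_eq_zero L ι t hτt', htr]
  have hdVim : ∀ p, (ι (dV p)).im = 0 := fun p => by
    have h1 : ι (cmConjRingHom L (dV p)) = starRingEnd ℂ (ι (dV p)) := embedding_cmConjRingHom L ι (dV p)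
    have h2 : cmConjRingHom L (dV p) = dV p := hdV p
    rw [h2] at h1
    exact Complex.conj_eq_iff_im.1 h1.symm
  have hedV : ∀ p, (cmPlace L ι).1.embedding (dV p) = (((ι (dV p)).re : ℝ) : ℂ) := fun p => by
    rw [embedding_cmPlace_apply_of_im_eq_zero L ι (dV p) (hdVim p)]
    exact Complex.ext (by simp) (by simp [hdVim p])
  -- the frame signs from the signature `(1,1)` of `ι(diag dV)`
  obtain ⟨T, hT'⟩ := hT
  rw [Matrix.diagonal_map (map_zero ι)] at hT'
  obtain ⟨pm, pp, hne, hmneg, hppos⟩ := exists_neg_pos_of_sig₂ (fun p => ι (dV p)) T hT'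
  have hre : ∀ p, ((cmPlace L ι).1.embedding (dV p) * ((cmPlace L ι).1.embedding t)⁻¹).re = (ι (dV p)).re * tr⁻¹ := fun p => by
    rw [hedV, het, ← Complex.ofReal_inv, ← Complex.ofReal_mul, Complex.ofReal_re]
  have hm : ((cmPlace L ι).1.embedding (dV pm) * ((cmPlace L ι).1.embedding t)⁻¹).re < 0 := by
    rw [hre]; exact mul_neg_of_neg_of_pos hmneg (inv_pos.2 htr0)
  have hp : 0 < ((cmPlace L ι).1.embedding (dV pp) * ((cmPlace L ι).1.embedding t)⁻¹).re := by
    rw [hre]; exact mul_pos hppos (inv_pos.2 htr0)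
  have hσt : ((cmPlace L ι).1.embedding t).im = 0 := by rw [het, Complex.ofReal_im]
  have key := re_mul_im_lt_zero_of_meets_of_hol₂ L H dV hdV hdV0 t ht g hg v₀ (cmPlace L ι) hv₀ hσt pm pp hne hm hp 𝔣 e₁ ιA hpin P μ' hμ' a'
    hmeets hhol
  rw [het, Complex.ofReal_re] at key
  by_contra hcon
  push Not at hcon
  exact absurd key (not_lt.2 (mul_nonneg htr0.le hcon))

end Summit.HodgeConjecture.HodgeConjecture.Cruxes.HLiu418.F0LD2ArchSignAt

end
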